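import Literature.Combinatorics.Matroid.HeppBound
import Mathlib.Algebra.BigOperators.Intervals
import Mathlib.Tactic.Ring
import Mathlib.Tactic.FieldSimp
import Mathlib.Tactic.FinCases
import HarnessLib

/-!
# Panzer's flag formula (Prop. 3.2): discharge of the named fact `Panzer2022_prop_3_2`

Topic `Combinatorics/Matroid`; sibling of `HeppBound.lean`, which states the fact. Source: E. Panzer,
*Hepp's bound for Feynman graphs and matroids*, AIHPD **10** (2023) 31–119 = arXiv:1908.09820
[Panzer2022], §3.1: Prop. 3.2 (the flag formula), its proof (pp. 16–17 of the arXiv version), and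
the recursion (eq. "hepp-flag-recursive") displayed after Ex. 3.5; §2.5 Prop. 2.24
(multiplicativity of the Parke–Taylor-like characters `Char` under shuffles) is the engine of the
printed proof.

## The printed proof and how it is formalised

Panzer groups the `N!` orderings `σ` of the edges according to the flag of bridgeless sets
`γ_k^σ = (M^σ_{i_k})°` (interior = union of circuits = non-bridges) and evaluates the sum over
the fibre of a flag by peeling off the LAST edge `e = σ(N)`: the remaining new edges
`S ∖ {e}` (`S = M ∖ γ_{ℓ-1}`) are bridges of `M ∖ e`, may sit anywhere in `σ`, and by the
multiplicativity `Char(w ⧢ [a_f]) = Char(w) / a_f` contribute the factor `1/a_f` each; summing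
over `e ∈ S` gives `a_{M/M'} / (a^S ω(M'))` times the same sum for the truncated flag, and
"iteration of this rule eventually leads to" the flag formula.

We formalise exactly this, pointwise in a field, organised as the recursion of §3.1:

* `sum_orderings_eq_sum_erase` — an ordering is its last edge plus an ordering of the rest
  (three bookkeeping lemmas on `orderings` are private copies of those of
  `HeppBoundIdentities.lean`, to keep this file independent of it);
* `charSum` bookkeeping (`cs`): the full product `Π_{k ≤ |F|} ω(F^τ_k)⁻¹` summed over orderings
  (Panzer's `Char(Δω^τ)`), versus the Hepp sum `Π_{k < |F|}` (his `dChar`);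
  `cs F = ω(F)⁻¹ · Hepp_D(F)` and `Hepp_D(E) = Σ_e cs (E ∖ e)`;
* `cs_erase_bridge` — Prop. 2.24 for the one-letter shuffle `w ⧢ [a_f]`, i.e. stripping a bridge
  `f` of `F` divides `cs` by `a_f` (proved by induction on `|F|`, pointwise where no partial sum
  vanishes);
* interior/bridge lemmas for an abstract corank function `ℓ` (normalised, monotone, unit
  increments, supermodular — the corank of a matroid): the interior `F°` is bridgeless of the
  same corank, and — the combinatorial heart of Panzer's fibre description — for bridgeless `E`,
  `M' ⊆ E` bridgeless with `ℓ(M') = ℓ(E) - 1` and `e ∉ M'`, `(E ∖ e)° = M'`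
  ("all remaining edges `S ∖ {e}` are bridges of `M ∖ e`");
* `heppSumOfCorank_recursion` — eq. (hepp-flag-recursive) in a free dimension `D`;
* `heppSumOfCorank_eq_heppFlagSumOfCorank` — the flag formula for an abstract corank function,
  by induction on `ℓ` (flags of `E` of length `ℓ` = flags of `M'` of length `ℓ - 1` extended by `E`);
* the matroid layer checks the corank axioms for `corank M` (Mathlib's `eRk`: monotone,
  `eRk_insert_le_add_one`, submodular) and that a connected matroid with `ℓ ≥ 1` is bridgeless
  (a bridge `e` would split `M = M|{e} ⊕ M|(E ∖ e)`, Def. 2.15 / §3.1), and concludes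
  `Panzer2022_prop_3_2_holds`.

Deviation from print: no shuffle algebra `ℤ⟨S⟩` is introduced; the only instance of Prop. 2.24
needed (shuffling with single letters `a_f`, one bridge at a time) is proved directly on sums over
orderings. Everything is an identity at a point `(D, a⃗)` of a field where the denominators named
in `Panzer2022_prop_3_2` do not vanish, which is what the fact asserts.

## References

* [Panzer2022] E. Panzer, *Hepp's bound for Feynman graphs and matroids*, AIHPD 10 (2023),
  doi:10.4171/aihpd/126, arXiv:1908.09820 — §2.5 Prop. 2.24, §3.1 Def. 3.1, Prop. 3.2 and its
  proof, eq. (hepp-flag-recursive) after Ex. 3.5.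
-/

noncomputable section

open Finset

namespace Literature.Combinatorics.Matroid

section Orderings

variable {α : Type*}

/-- An ordering of `E` enumerates exactly the elements of `E` (private copy of the lemma of
`HeppBoundIdentities.lean`). [folklore] -/
private theorem mem_iff_of_mem_orderings' {E : Finset α} {l : List α} (h : l ∈ orderings E)
    {x : α} : x ∈ l ↔ x ∈ E := by
  rw [mem_orderings_iff] at h
  rw [← Finset.mem_val, ← h, Multiset.mem_coe]

/-- The underlying finite set of an ordering of `E` is `E` (private copy of the lemma of
`HeppBoundIdentities.lean`). [folklore] -/
private theorem toFinset_eq_of_mem_orderings' [DecidableEq α] {E : Finset α} {l : List α}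
    (h : l ∈ orderings E) : l.toFinset = E := by
  ext x
  rw [List.mem_toFinset, mem_iff_of_mem_orderings' h]

/-- An ordering of `E` has length `|E|` (private copy of the lemma of
`HeppBoundIdentities.lean`). [folklore] -/
private theorem length_of_mem_orderings' {E : Finset α} {l : List α} (h : l ∈ orderings E) :
    l.length = E.card := by
  rw [mem_orderings_iff] at h
  rw [← Multiset.coe_card, h, Finset.card_val]

/-- The only ordering of the empty set is the empty list. [folklore] -/
theorem orderings_empty : orderings (∅ : Finset α) = {[]} := by
  ext l
  rw [mem_orderings_iff, Finset.mem_singleton, Finset.empty_val, Multiset.coe_eq_zero]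

/-- Appending a last element: `l ++ [e]` is an ordering of `E` iff `e ∈ E` and `l` is an ordering
of `E ∖ e` (the decomposition `σ = (σ', σ(N))` of Panzer's proof of Prop. 3.2). [folklore] -/
theorem append_singleton_mem_orderings_iff [DecidableEq α] {E : Finset α} {l : List α} {e : α} :
    l ++ [e] ∈ orderings E ↔ e ∈ E ∧ l ∈ orderings (E.erase e) := by
  rw [mem_orderings_iff, mem_orderings_iff, Finset.erase_val]
  have hc : ((l ++ [e] : List α) : Multiset α) = e ::ₘ (l : Multiset α) := by
    rw [← Multiset.coe_add, Multiset.coe_singleton, add_comm, Multiset.singleton_add]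
  rw [hc]
  constructor
  · intro h
    have he : e ∈ E := by
      rw [← Finset.mem_val, ← h]
      exact Multiset.mem_cons_self e _
    refine ⟨he, ?_⟩
    have h' : e ::ₘ (l : Multiset α) = e ::ₘ E.val.erase e := by
      rw [h, Multiset.cons_erase (Finset.mem_val.mpr he)]
    exact (Multiset.cons_inj_right e).mp h'
  · rintro ⟨he, h⟩
    rw [h, Multiset.cons_erase (Finset.mem_val.mpr he)]

/-- **Last-edge decomposition of a sum over orderings**: summing `f` over all orderings of a
non-empty `E` is summing, over the last element `e` and the orderings `l` of `E ∖ e`, the values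
`f (l ++ [e])`. [folklore] -/
theorem sum_orderings_eq_sum_erase [DecidableEq α] {β : Type*} [AddCommMonoid β] {E : Finset α}
    (hE : E.Nonempty) (f : List α → β) :
    ∑ l ∈ orderings E, f l = ∑ e ∈ E, ∑ l ∈ orderings (E.erase e), f (l ++ [e]) := by
  rw [← Finset.sum_sigma E (fun e => orderings (E.erase e)) (fun p => f (p.2 ++ [p.1]))]
  symm
  refine Finset.sum_bij (fun p _ => p.2 ++ [p.1]) ?_ ?_ ?_ ?_
  · rintro ⟨e, l⟩ hp
    rw [Finset.mem_sigma] at hp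
    exact append_singleton_mem_orderings_iff.mpr hp
  · rintro ⟨e₁, l₁⟩ _ ⟨e₂, l₂⟩ _ heq
    obtain ⟨hl, he⟩ := List.append_inj' heq rfl
    obtain rfl : e₁ = e₂ := List.singleton_inj.mp he
    subst hl
    rfl
  · intro l hl
    have hne : l ≠ [] := by
      rintro rfl
      obtain ⟨x, hx⟩ := hE
      rw [← mem_iff_of_mem_orderings' hl] at hx
      simp at hx
    refine ⟨⟨l.getLast hne, l.dropLast⟩, ?_, List.dropLast_append_getLast hne⟩
    rw [Finset.mem_sigma]
    exact append_singleton_mem_orderings_iff.mp (by rw [List.dropLast_append_getLast hne]; exact hl)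
  · intro p _
    rfl

end Orderings

section CharSums

variable {α : Type*} [DecidableEq α] {𝕜 : Type*} [Field 𝕜]

/-- **Last-edge decomposition of the Hepp sum** (`dChar` does not see the last letter, Panzer
§2.5): for non-empty `E`,
`Hepp_D(E) = Σ_{e ∈ E} cs(E ∖ e)`, where `cs(F) = Σ_{τ} Π_{k=1}^{|F|} ω(F^τ_k)⁻¹` is the sum of
the full characters `Char(Δω^τ)` over the orderings `τ` of `F`. The function `cs` is passed as an
argument together with its defining equation `hcs`. [cite: Panzer2022, §2.5 and proof of Prop. 3.2] -/
theorem heppSumOfCorank_eq_sum_charSum_erase (ℓ : Finset α → ℕ) (D : 𝕜) (a : α → 𝕜)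
    (cs : Finset α → 𝕜)
    (hcs : ∀ F, cs F = ∑ τ ∈ orderings F, ∏ k ∈ Finset.Ico 1 (F.card + 1),
      (sdcOfCorank ℓ D a (τ.take k).toFinset)⁻¹)
    {E : Finset α} (hE : E.Nonempty) :
    heppSumOfCorank ℓ E D a = ∑ e ∈ E, cs (E.erase e) := by
  rw [heppSumOfCorank_eq, sum_orderings_eq_sum_erase hE]
  refine Finset.sum_congr rfl fun e he => ?_
  rw [hcs, Finset.card_erase_add_one he]
  refine Finset.sum_congr rfl fun l hl => ?_
  refine Finset.prod_congr rfl fun k hk => ?_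
  rw [Finset.mem_Ico] at hk
  have hlen := length_of_mem_orderings' hl
  have hcard := Finset.card_erase_add_one he
  rw [List.take_append_of_le_length (by omega)]

/-- `cs(F) = ω(F)⁻¹ · Hepp_D(F)` for non-empty `F`: the last factor of the full character is
`ω(F^τ_{|F|}) = ω(F)` for every ordering `τ` (`dChar(w) = |w| · Char(w)`, Panzer §2.5). [cite: Panzer2022, §2.5] -/
theorem charSum_eq_inv_mul_heppSumOfCorank (ℓ : Finset α → ℕ) (D : 𝕜) (a : α → 𝕜)
    (cs : Finset α → 𝕜)
    (hcs : ∀ F, cs F = ∑ τ ∈ orderings F, ∏ k ∈ Finset.Ico 1 (F.card + 1),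
      (sdcOfCorank ℓ D a (τ.take k).toFinset)⁻¹)
    {F : Finset α} (hF : F.Nonempty) :
    cs F = (sdcOfCorank ℓ D a F)⁻¹ * heppSumOfCorank ℓ F D a := by
  rw [hcs, heppSumOfCorank_eq, Finset.mul_sum]
  refine Finset.sum_congr rfl fun τ hτ => ?_
  rw [Finset.prod_Ico_succ_top (Finset.card_pos.mpr hF), mul_comm]
  congr 2
  rw [← length_of_mem_orderings' hτ, List.take_length, toFinset_eq_of_mem_orderings' hτ]

/-- The recursion for the full characters: for non-empty `F`,
`cs(F) = ω(F)⁻¹ · Σ_{g ∈ F} cs(F ∖ g)`. [cite: Panzer2022, §2.5] -/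
theorem charSum_eq_inv_mul_sum_erase (ℓ : Finset α → ℕ) (D : 𝕜) (a : α → 𝕜)
    (cs : Finset α → 𝕜)
    (hcs : ∀ F, cs F = ∑ τ ∈ orderings F, ∏ k ∈ Finset.Ico 1 (F.card + 1),
      (sdcOfCorank ℓ D a (τ.take k).toFinset)⁻¹)
    {F : Finset α} (hF : F.Nonempty) :
    cs F = (sdcOfCorank ℓ D a F)⁻¹ * ∑ g ∈ F, cs (F.erase g) := by
  rw [charSum_eq_inv_mul_heppSumOfCorank ℓ D a cs hcs hF,
    heppSumOfCorank_eq_sum_charSum_erase ℓ D a cs hcs hF]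

/-- The full character sum of the empty set is `1` (one empty ordering, empty product:
`Char` of the empty word is `1`, Panzer §2.5). [cite: Panzer2022, §2.5] -/
theorem charSum_empty (ℓ : Finset α → ℕ) (D : 𝕜) (a : α → 𝕜)
    (cs : Finset α → 𝕜)
    (hcs : ∀ F, cs F = ∑ τ ∈ orderings F, ∏ k ∈ Finset.Ico 1 (F.card + 1),
      (sdcOfCorank ℓ D a (τ.take k).toFinset)⁻¹) :
    cs ∅ = 1 := by
  rw [hcs, orderings_empty, Finset.sum_singleton, Finset.card_empty]
  simp

omit [DecidableEq α] in
/-- The superficial degree of convergence of the empty set vanishes when `ℓ(∅) = 0`. [folklore] -/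
theorem sdcOfCorank_empty (ℓ : Finset α → ℕ) (h0 : ℓ ∅ = 0) (D : 𝕜) (a : α → 𝕜) :
    sdcOfCorank ℓ D a ∅ = 0 := by
  rw [sdcOfCorank_apply, Finset.sum_empty, h0, Nat.cast_zero, mul_zero, sub_zero]

/-- Removing a bridge `f` (an edge with `ℓ(γ ∖ f) = ℓ(γ)` throughout `F`) changes `ω` by `a_f`:
`ω(F) = ω(F ∖ f) + a_f`. [cite: Panzer2022, §2.5 (increments Δω)] -/
theorem sdcOfCorank_eq_erase_add (ℓ : Finset α → ℕ) (D : 𝕜) (a : α → 𝕜) {F : Finset α} {f : α}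
    (hf : f ∈ F) (hbr : ℓ (F.erase f) = ℓ F) :
    sdcOfCorank ℓ D a F = sdcOfCorank ℓ D a (F.erase f) + a f := by
  rw [sdcOfCorank_apply, sdcOfCorank_apply, ← Finset.sum_erase_add F a hf, hbr]
  ring

/-- **Stripping a bridge divides the character sum by its index** (Panzer's Prop. 2.24,
`Char(w ⧢ [a_f]) = Char(w) · Char([a_f]) = Char(w)/a_f`, for the increment words of the orderings
of `F ∖ f` shuffled with the bridge `f`; pointwise wherever no `ω(γ)`, `∅ ≠ γ ⊆ F`, and `a_f`
vanish). Proved by induction on `|F|` through the recursion `charSum_eq_inv_mul_sum_erase`. [cite: Panzer2022, Prop. 2.24 and proof of Prop. 3.2] -/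
theorem charSum_eq_charSum_erase_bridge (ℓ : Finset α → ℕ) (h0 : ℓ ∅ = 0) (D : 𝕜) (a : α → 𝕜)
    (cs : Finset α → 𝕜)
    (hcs : ∀ F, cs F = ∑ τ ∈ orderings F, ∏ k ∈ Finset.Ico 1 (F.card + 1),
      (sdcOfCorank ℓ D a (τ.take k).toFinset)⁻¹)
    (F : Finset α) {f : α} (hf : f ∈ F) (hbr : ∀ γ ⊆ F, f ∈ γ → ℓ (γ.erase f) = ℓ γ)
    (hω : ∀ γ ⊆ F, γ.Nonempty → sdcOfCorank ℓ D a γ ≠ 0) (haf : a f ≠ 0) :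
    cs F = cs (F.erase f) * (a f)⁻¹ := by
  induction F using Finset.strongInduction with
  | H F ih =>
    have hF : F.Nonempty := ⟨f, hf⟩
    rw [charSum_eq_inv_mul_sum_erase ℓ D a cs hcs hF, ← Finset.add_sum_erase F _ hf]
    have key : ∑ g ∈ F.erase f, cs (F.erase g) =
        (∑ g ∈ F.erase f, cs ((F.erase f).erase g)) * (a f)⁻¹ := by
      rw [Finset.sum_mul]
      refine Finset.sum_congr rfl fun g hg => ?_
      have hgf : g ≠ f := Finset.ne_of_mem_erase hg
      have hgF : g ∈ F := Finset.mem_of_mem_erase hg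
      rw [ih (F.erase g) (Finset.erase_ssubset hgF) (Finset.mem_erase.mpr ⟨hgf.symm, hf⟩)
          (fun γ hγ hfγ => hbr γ (hγ.trans (Finset.erase_subset g F)) hfγ)
          (fun γ hγ hne => hω γ (hγ.trans (Finset.erase_subset g F)) hne),
        Finset.erase_right_comm]
    have hsum : ∑ g ∈ F.erase f, cs ((F.erase f).erase g) =
        sdcOfCorank ℓ D a (F.erase f) * cs (F.erase f) := by
      rcases (F.erase f).eq_empty_or_nonempty with h | h
      · rw [h, Finset.sum_empty, sdcOfCorank_empty ℓ h0, zero_mul]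
      · rw [charSum_eq_inv_mul_sum_erase ℓ D a cs hcs h, ← mul_assoc,
          mul_inv_cancel₀ (hω _ (Finset.erase_subset f F) h), one_mul]
    have hωF := sdcOfCorank_eq_erase_add ℓ D a hf (hbr F Finset.Subset.rfl hf)
    have hF0 := hω F Finset.Subset.rfl hF
    rw [key, hsum]
    rw [hωF] at hF0 ⊢
    field_simp
    ring

end CharSums

section Bridges

/-! ### Bridges and interiors for an abstract corank function

Here `ℓ : Finset α → ℕ` is monotone, has unit increments and is supermodular — the properties of
the corank `γ ↦ |γ| - rk γ` of a matroid used by the argument. A *bridge* of `F` is an `f ∈ F`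
with `ℓ(F ∖ f) = ℓ(F)`; the *interior* `F°` (passed as a function `intr` with its defining
equation) is the set of non-bridges (Panzer 2022, §3.1, `M° = M ∖ B(M)`). -/

variable {α : Type*} [DecidableEq α]

/-- For `f ∈ γ ⊆ F`: `γ ∪ (F ∖ f) = F`. [folklore] -/
theorem union_erase_eq_of_subset {F γ : Finset α} {f : α} (hγ : γ ⊆ F) (hf : f ∈ γ) :
    γ ∪ F.erase f = F := by
  ext x
  simp only [Finset.mem_union, Finset.mem_erase]
  constructor
  · rintro (hx | ⟨-, hx⟩)
    · exact hγ hx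
    · exact hx
  · intro hx
    by_cases hxf : x = f
    · subst hxf
      exact Or.inl hf
    · exact Or.inr ⟨hxf, hx⟩

/-- A bridge of `F` is a bridge of every subset of `F` containing it (supermodularity of the
corank; Panzer 2022, §3.1: bridges are the edges in no circuit). [cite: Panzer2022, §3.1] -/
theorem corank_erase_eq_of_bridge (ℓ : Finset α → ℕ)
    (hmono : ∀ γ δ : Finset α, γ ⊆ δ → ℓ γ ≤ ℓ δ)
    (hsup : ∀ A B : Finset α, ℓ A + ℓ B ≤ ℓ (A ∪ B) + ℓ (A ∩ B))
    {F γ : Finset α} {f : α} (hbr : ℓ (F.erase f) = ℓ F) (hγ : γ ⊆ F) (hf : f ∈ γ) :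
    ℓ (γ.erase f) = ℓ γ := by
  have h1 := hsup γ (F.erase f)
  rw [union_erase_eq_of_subset hγ hf, Finset.inter_erase, Finset.inter_eq_left.mpr hγ, hbr] at h1
  have h2 := hmono (γ.erase f) γ (Finset.erase_subset f γ)
  omega

/-- Deleting a set `B` of bridges of `F` does not change the corank. [cite: Panzer2022, §3.1] -/
theorem corank_sdiff_bridges (ℓ : Finset α → ℕ)
    (hmono : ∀ γ δ : Finset α, γ ⊆ δ → ℓ γ ≤ ℓ δ)
    (hsup : ∀ A B : Finset α, ℓ A + ℓ B ≤ ℓ (A ∪ B) + ℓ (A ∩ B)) (B : Finset α) :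
    ∀ F : Finset α, B ⊆ F.filter (fun f => ℓ (F.erase f) = ℓ F) → ℓ (F \ B) = ℓ F := by
  induction B using Finset.induction_on with
  | empty => intro F _; rw [Finset.sdiff_empty]
  | insert f B hfB ih =>
    intro F hB
    have hf : f ∈ F.filter (fun f => ℓ (F.erase f) = ℓ F) := hB (Finset.mem_insert_self f B)
    rw [Finset.mem_filter] at hf
    have hB' : B ⊆ (F.erase f).filter (fun g => ℓ ((F.erase f).erase g) = ℓ (F.erase f)) := by
      intro g hg
      have hg' := hB (Finset.mem_insert_of_mem hg)
      rw [Finset.mem_filter] at hg' ⊢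
      have hgf : g ≠ f := fun h => hfB (h ▸ hg)
      exact ⟨Finset.mem_erase.mpr ⟨hgf, hg'.1⟩, corank_erase_eq_of_bridge ℓ hmono hsup hg'.2
        (Finset.erase_subset f F) (Finset.mem_erase.mpr ⟨hgf, hg'.1⟩)⟩
    rw [Finset.sdiff_insert, ← Finset.erase_sdiff_comm, ih (F.erase f) hB', hf.2]

/-- The interior `F°` (non-bridges) is a subset of `F`. [cite: Panzer2022, §3.1] -/
theorem interior_subset (ℓ : Finset α → ℕ) (intr : Finset α → Finset α)
    (hintr : ∀ F, intr F = F.filter fun f => ℓ (F.erase f) < ℓ F) (F : Finset α) :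
    intr F ⊆ F := by
  rw [hintr]; exact Finset.filter_subset _ F

/-- The complement of the interior consists of bridges: `F ∖ F° ⊆ B(F)` (Panzer 2022, §3.1,
`M° = M ∖ B(M)`). [cite: Panzer2022, §3.1] -/
theorem sdiff_interior_subset_bridges (ℓ : Finset α → ℕ)
    (hmono : ∀ γ δ : Finset α, γ ⊆ δ → ℓ γ ≤ ℓ δ) (intr : Finset α → Finset α)
    (hintr : ∀ F, intr F = F.filter fun f => ℓ (F.erase f) < ℓ F) (F : Finset α) :
    F \ intr F ⊆ F.filter (fun f => ℓ (F.erase f) = ℓ F) := by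
  intro f hf
  rw [hintr, Finset.mem_sdiff, Finset.mem_filter] at hf
  rw [Finset.mem_filter]
  have h1 := hmono _ _ (Finset.erase_subset f F)
  refine ⟨hf.1, ?_⟩
  have h2 : ¬ ℓ (F.erase f) < ℓ F := fun h => hf.2 ⟨hf.1, h⟩
  omega

/-- The interior has the same corank: `ℓ(F°) = ℓ(F)`. [cite: Panzer2022, §3.1] -/
theorem corank_interior (ℓ : Finset α → ℕ)
    (hmono : ∀ γ δ : Finset α, γ ⊆ δ → ℓ γ ≤ ℓ δ)
    (hsup : ∀ A B : Finset α, ℓ A + ℓ B ≤ ℓ (A ∪ B) + ℓ (A ∩ B)) (intr : Finset α → Finset α)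
    (hintr : ∀ F, intr F = F.filter fun f => ℓ (F.erase f) < ℓ F) (F : Finset α) :
    ℓ (intr F) = ℓ F := by
  have h := corank_sdiff_bridges ℓ hmono hsup (F \ intr F) F
    (sdiff_interior_subset_bridges ℓ hmono intr hintr F)
  rwa [Finset.sdiff_sdiff_eq_self (interior_subset ℓ intr hintr F)] at h

/-- The interior is bridgeless (it is the largest bridgeless subset; Panzer 2022, §3.1). [cite: Panzer2022, §3.1] -/
theorem interior_bridgeless (ℓ : Finset α → ℕ)
    (hmono : ∀ γ δ : Finset α, γ ⊆ δ → ℓ γ ≤ ℓ δ)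
    (hsup : ∀ A B : Finset α, ℓ A + ℓ B ≤ ℓ (A ∪ B) + ℓ (A ∩ B)) (intr : Finset α → Finset α)
    (hintr : ∀ F, intr F = F.filter fun f => ℓ (F.erase f) < ℓ F) (F : Finset α) :
    IsBridgelessOfCorank ℓ (intr F) := by
  intro g hg
  have hℓ := corank_interior ℓ hmono hsup intr hintr F
  have hsub := interior_subset ℓ intr hintr F
  rw [hintr, Finset.mem_filter] at hg
  have h1 := hmono _ _ (Finset.erase_subset_erase g hsub)
  omega

/-- In a bridgeless set every deletion lowers the corank by exactly one. [cite: Panzer2022, §3.1] -/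
theorem corank_erase_add_one_of_bridgeless (ℓ : Finset α → ℕ)
    (hstep : ∀ (γ : Finset α) (e : α), ℓ γ ≤ ℓ (γ.erase e) + 1) {E : Finset α}
    (hbr : IsBridgelessOfCorank ℓ E) {e : α} (he : e ∈ E) :
    ℓ (E.erase e) + 1 = ℓ E := by
  have h1 := hbr e he
  have h2 := hstep E e
  omega

/-- **The fibre lemma of Panzer's proof of Prop. 3.2**: if `E` is bridgeless, `M' ⊆ E` is
bridgeless with `ℓ(M') = ℓ(E) - 1` and `e ∈ E ∖ M'`, then the interior of `E ∖ e` is `M'` —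
"all remaining edges `S ∖ {e}` are bridges of `M ∖ e`", and no edge of `M'` is. [cite: Panzer2022, proof of Prop. 3.2] -/
theorem interior_erase_eq_of_bridgeless (ℓ : Finset α → ℕ)
    (hmono : ∀ γ δ : Finset α, γ ⊆ δ → ℓ γ ≤ ℓ δ)
    (hstep : ∀ (γ : Finset α) (e : α), ℓ γ ≤ ℓ (γ.erase e) + 1)
    (hsup : ∀ A B : Finset α, ℓ A + ℓ B ≤ ℓ (A ∪ B) + ℓ (A ∩ B)) (intr : Finset α → Finset α)
    (hintr : ∀ F, intr F = F.filter fun f => ℓ (F.erase f) < ℓ F)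
    {E : Finset α} (hbrE : IsBridgelessOfCorank ℓ E) {e : α} (he : e ∈ E)
    {M' : Finset α} (hM'E : M' ⊆ E) (heM' : e ∉ M') (hbrM' : IsBridgelessOfCorank ℓ M')
    (hℓ : ℓ M' + 1 = ℓ E) :
    intr (E.erase e) = M' := by
  have hℓF : ℓ (E.erase e) = ℓ M' := by
    have := corank_erase_add_one_of_bridgeless ℓ hstep hbrE he
    omega
  have hM'F : M' ⊆ E.erase e :=
    fun x hx => Finset.mem_erase.mpr ⟨fun h => heM' (h ▸ hx), hM'E hx⟩
  rw [hintr]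
  ext g
  simp only [Finset.mem_filter]
  constructor
  · rintro ⟨-, hlt⟩
    by_contra hgM'
    have h1 : M' ⊆ (E.erase e).erase g :=
      fun x hx => Finset.mem_erase.mpr ⟨fun h => hgM' (h ▸ hx), hM'F hx⟩
    have := hmono _ _ h1
    omega
  · intro hgM'
    refine ⟨hM'F hgM', ?_⟩
    have h1 := hsup M' ((E.erase e).erase g)
    rw [union_erase_eq_of_subset hM'F hgM', Finset.inter_erase, Finset.inter_eq_left.mpr hM'F] at h1
    have h2 := hbrM' g hgM'
    omega

end Bridges

section Recursion

variable {α : Type*} [DecidableEq α] {𝕜 : Type*} [Field 𝕜]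

/-- Deleting a set `B` of bridges of `F` divides the character sum by `Π_{f ∈ B} a_f`
(iteration of `charSum_eq_charSum_erase_bridge`; Panzer: the bridges "may appear in any order and
at arbitrary positions in `σ`", contributing `1/a^{S ∖ e}` by Prop. 2.24). [cite: Panzer2022, proof of Prop. 3.2] -/
theorem charSum_eq_charSum_sdiff_bridges (ℓ : Finset α → ℕ) (h0 : ℓ ∅ = 0)
    (hmono : ∀ γ δ : Finset α, γ ⊆ δ → ℓ γ ≤ ℓ δ)
    (hsup : ∀ A B : Finset α, ℓ A + ℓ B ≤ ℓ (A ∪ B) + ℓ (A ∩ B))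
    (D : 𝕜) (a : α → 𝕜) (cs : Finset α → 𝕜)
    (hcs : ∀ F, cs F = ∑ τ ∈ orderings F, ∏ k ∈ Finset.Ico 1 (F.card + 1),
      (sdcOfCorank ℓ D a (τ.take k).toFinset)⁻¹) (B : Finset α) :
    ∀ F : Finset α, B ⊆ F.filter (fun f => ℓ (F.erase f) = ℓ F) →
      (∀ γ ⊆ F, γ.Nonempty → sdcOfCorank ℓ D a γ ≠ 0) → (∀ f ∈ B, a f ≠ 0) →
        cs F = cs (F \ B) * (∏ f ∈ B, a f)⁻¹ := by
  induction B using Finset.induction_on with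
  | empty => intro F _ _ _; rw [Finset.sdiff_empty, Finset.prod_empty, inv_one, mul_one]
  | insert f B hfB ih =>
    intro F hB hω ha
    have hf : f ∈ F.filter (fun f => ℓ (F.erase f) = ℓ F) := hB (Finset.mem_insert_self f B)
    rw [Finset.mem_filter] at hf
    have hB' : B ⊆ (F.erase f).filter (fun g => ℓ ((F.erase f).erase g) = ℓ (F.erase f)) := by
      intro g hg
      have hg' := hB (Finset.mem_insert_of_mem hg)
      rw [Finset.mem_filter] at hg' ⊢
      have hgf : g ≠ f := fun h => hfB (h ▸ hg)
      exact ⟨Finset.mem_erase.mpr ⟨hgf, hg'.1⟩, corank_erase_eq_of_bridge ℓ hmono hsup hg'.2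
        (Finset.erase_subset f F) (Finset.mem_erase.mpr ⟨hgf, hg'.1⟩)⟩
    rw [charSum_eq_charSum_erase_bridge ℓ h0 D a cs hcs F hf.1
        (fun γ hγ hfγ => corank_erase_eq_of_bridge ℓ hmono hsup hf.2 hγ hfγ) hω
        (ha f (Finset.mem_insert_self f B)),
      ih (F.erase f) hB' (fun γ hγ hne => hω γ (hγ.trans (Finset.erase_subset f F)) hne)
        (fun g hg => ha g (Finset.mem_insert_of_mem hg)),
      Finset.sdiff_insert, ← Finset.erase_sdiff_comm, Finset.prod_insert hfB, mul_inv]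
    ring

/-- **Panzer's recursion for the Hepp bound over bridgeless subsets of corank `ℓ - 1`**
(eq. (hepp-flag-recursive) of §3.1, in a free dimension `D`, with the character sum
`cs(γ) = Hepp_D(γ)/ω(γ)` for `γ ≠ ∅` and `cs(∅) = 1`): for bridgeless `E` with `ℓ(E) ≥ 1`,
`Hepp_D(E, a⃗) = Σ_{γ ⊊ E bridgeless, ℓ(γ) = ℓ(E) - 1} (a_{E/γ} / a^{E ∖ γ}) · cs(γ)`,
pointwise wherever `ω(γ) ≠ 0` for `∅ ≠ γ ⊊ E` and `a_e ≠ 0`. This is the content of the proof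
of Prop. 3.2 (sum over the fibre of a flag, last edge `e ∈ S = E ∖ γ`). [cite: Panzer2022, Prop. 3.2 (proof) and eq. (hepp-flag-recursive)] -/
theorem heppSumOfCorank_recursion (ℓ : Finset α → ℕ) (h0 : ℓ ∅ = 0)
    (hmono : ∀ γ δ : Finset α, γ ⊆ δ → ℓ γ ≤ ℓ δ)
    (hstep : ∀ (γ : Finset α) (e : α), ℓ γ ≤ ℓ (γ.erase e) + 1)
    (hsup : ∀ A B : Finset α, ℓ A + ℓ B ≤ ℓ (A ∪ B) + ℓ (A ∩ B))
    (D : 𝕜) (a : α → 𝕜) (cs : Finset α → 𝕜)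
    (hcs : ∀ F, cs F = ∑ τ ∈ orderings F, ∏ k ∈ Finset.Ico 1 (F.card + 1),
      (sdcOfCorank ℓ D a (τ.take k).toFinset)⁻¹)
    {E : Finset α} (hbr : IsBridgelessOfCorank ℓ E) (hℓ : 1 ≤ ℓ E)
    (hω : ∀ γ ⊆ E, γ.Nonempty → γ ≠ E → sdcOfCorank ℓ D a γ ≠ 0) (ha : ∀ e ∈ E, a e ≠ 0) :
    heppSumOfCorank ℓ E D a =
      ∑ M' ∈ E.powerset.filter (fun M' => IsBridgelessOfCorank ℓ M' ∧ ℓ M' + 1 = ℓ E),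
        (∑ e ∈ E \ M', a e) * (∏ e ∈ E \ M', a e)⁻¹ * cs M' := by
  obtain ⟨intr, hintr⟩ : ∃ intr : Finset α → Finset α,
      ∀ F, intr F = F.filter fun f => ℓ (F.erase f) < ℓ F := ⟨_, fun F => rfl⟩
  have hE : E.Nonempty := by
    rw [Finset.nonempty_iff_ne_empty]
    rintro rfl
    rw [h0] at hℓ
    omega
  rw [heppSumOfCorank_eq_sum_charSum_erase ℓ D a cs hcs hE]
  have step : ∀ e ∈ E, cs (E.erase e) =
      cs (intr (E.erase e)) * (∏ f ∈ E.erase e \ intr (E.erase e), a f)⁻¹ := by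
    intro e he
    have hωF : ∀ γ ⊆ E.erase e, γ.Nonempty → sdcOfCorank ℓ D a γ ≠ 0 := fun γ hγ hne =>
      hω γ (hγ.trans (Finset.erase_subset e E)) hne
        (fun h => Finset.notMem_erase e E (hγ (by rw [h]; exact he)))
    have h := charSum_eq_charSum_sdiff_bridges ℓ h0 hmono hsup D a cs hcs
      (E.erase e \ intr (E.erase e)) (E.erase e)
      (sdiff_interior_subset_bridges ℓ hmono intr hintr _) hωF
      (fun f hf => ha f (Finset.erase_subset e E (Finset.mem_sdiff.mp hf).1))
    rwa [Finset.sdiff_sdiff_eq_self (interior_subset ℓ intr hintr _)] at h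
  have maps : ∀ e ∈ E, intr (E.erase e) ∈
      E.powerset.filter (fun M' => IsBridgelessOfCorank ℓ M' ∧ ℓ M' + 1 = ℓ E) := by
    intro e he
    rw [Finset.mem_filter, Finset.mem_powerset]
    refine ⟨(interior_subset ℓ intr hintr _).trans (Finset.erase_subset e E),
      interior_bridgeless ℓ hmono hsup intr hintr _, ?_⟩
    rw [corank_interior ℓ hmono hsup intr hintr, corank_erase_add_one_of_bridgeless ℓ hstep hbr he]
  rw [← Finset.sum_fiberwise_of_maps_to maps]
  refine Finset.sum_congr rfl fun M' hM' => ?_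
  rw [Finset.mem_filter, Finset.mem_powerset] at hM'
  obtain ⟨hM'E, hbrM', hℓM'⟩ := hM'
  have fiber : E.filter (fun e => intr (E.erase e) = M') = E \ M' := by
    ext e
    simp only [Finset.mem_filter, Finset.mem_sdiff]
    constructor
    · rintro ⟨he, h⟩
      refine ⟨he, fun heM' => ?_⟩
      rw [← h] at heM'
      exact Finset.notMem_erase e E (interior_subset ℓ intr hintr _ heM')
    · rintro ⟨he, heM'⟩
      exact ⟨he, interior_erase_eq_of_bridgeless ℓ hmono hstep hsup intr hintr hbr he hM'E heM'
        hbrM' hℓM'⟩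
  rw [fiber, Finset.sum_mul, Finset.sum_mul]
  refine Finset.sum_congr rfl fun e he => ?_
  rw [Finset.mem_sdiff] at he
  rw [step e he.1, interior_erase_eq_of_bridgeless ℓ hmono hstep hsup intr hintr hbr he.1 hM'E
      he.2 hbrM' hℓM', Finset.erase_sdiff_comm,
    ← Finset.mul_prod_erase (E \ M') a (Finset.mem_sdiff.mpr he)]
  have hae := ha e he.1
  field_simp

end Recursion

section FlagFormula

variable {α : Type*} [DecidableEq α] {𝕜 : Type*} [Field 𝕜]

/-- Extending flags by the top element: for bridgeless `E` with `ℓ(E) = m + 1`, the flags of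
`E` of length `m + 1` are exactly the flags of length `m` of the bridgeless `M' ⊆ E` with
`ℓ(M') = m`, followed by `E` ("iteration of this rule", proof of Prop. 3.2; the truncated flag
`γ'_•` of `γ_•`). The flag sets are passed as a function `fl` with its membership
characterisation `hfl`. [cite: Panzer2022, proof of Prop. 3.2] -/
theorem sum_flags_succ (ℓ : Finset α → ℕ)
    (fl : (m : ℕ) → Finset α → Finset (Fin (m + 1) → Finset α))
    (hfl : ∀ (m : ℕ) (E : Finset α) (γ : Fin (m + 1) → Finset α), γ ∈ fl m E ↔
      (∀ i, γ i ⊆ E) ∧ γ 0 = ∅ ∧ γ (Fin.last m) = E ∧ (∀ i : Fin m, γ i.castSucc ⊂ γ i.succ) ∧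
        ∀ i : Fin (m + 1), IsBridgelessOfCorank ℓ (γ i) ∧ ℓ (γ i) = (i : ℕ))
    {β : Type*} [AddCommMonoid β] (m : ℕ) {E : Finset α} (hbrE : IsBridgelessOfCorank ℓ E)
    (hℓE : ℓ E = m + 1) (Φ : (Fin (m + 1 + 1) → Finset α) → β) :
    ∑ γ ∈ fl (m + 1) E, Φ γ =
      ∑ M' ∈ E.powerset.filter (fun M' => IsBridgelessOfCorank ℓ M' ∧ ℓ M' + 1 = ℓ E),
        ∑ γ' ∈ fl m M', Φ (Fin.snoc γ' E) := by
  rw [← Finset.sum_sigma _ (fun M' => fl m M') (fun p => Φ (Fin.snoc p.2 E))]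
  refine Finset.sum_nbij'
    (fun γ => (⟨γ (Fin.last m).castSucc, Fin.init γ⟩ : Σ _ : Finset α, Fin (m + 1) → Finset α))
    (fun p => (Fin.snoc p.2 E : Fin (m + 1 + 1) → Finset α)) ?_ ?_ ?_ ?_ ?_
  · intro γ hγ
    rw [hfl] at hγ
    obtain ⟨hsub, hzero, hlast, hchain, hbl⟩ := hγ
    have hmonoγ : Monotone γ := (Fin.strictMono_iff_lt_succ.mpr hchain).monotone
    rw [Finset.mem_sigma, Finset.mem_filter, Finset.mem_powerset, hfl]
    refine ⟨⟨hsub _, (hbl _).1, ?_⟩, ?_, ?_, rfl, ?_, ?_⟩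
    · rw [(hbl _).2, hℓE, Fin.val_castSucc, Fin.val_last]
    · intro i
      exact hmonoγ (Fin.castSucc_le_castSucc_iff.mpr (Fin.le_last i))
    · show γ (Fin.castSucc 0) = ∅
      rw [Fin.castSucc_zero]
      exact hzero
    · intro i
      show γ i.castSucc.castSucc ⊂ γ i.succ.castSucc
      rw [← Fin.succ_castSucc]
      exact hchain _
    · intro i
      show IsBridgelessOfCorank ℓ (γ i.castSucc) ∧ ℓ (γ i.castSucc) = (i : ℕ)
      rw [← Fin.val_castSucc i]
      exact hbl _
  · rintro ⟨M', γ'⟩ hp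
    rw [Finset.mem_sigma, Finset.mem_filter, Finset.mem_powerset] at hp
    obtain ⟨⟨hM'E, -, hℓM'⟩, hγ'⟩ := hp
    rw [hfl] at hγ'
    obtain ⟨hsub, hzero, hlast, hchain, hbl⟩ := hγ'
    rw [hfl]
    refine ⟨?_, ?_, ?_, ?_, ?_⟩
    · intro i
      rcases Fin.eq_castSucc_or_eq_last i with ⟨j, rfl⟩ | rfl
      · rw [Fin.snoc_castSucc]
        exact (hsub j).trans hM'E
      · rw [Fin.snoc_last]
    · rw [← Fin.castSucc_zero, Fin.snoc_castSucc]
      exact hzero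
    · exact Fin.snoc_last _ _
    · intro i
      rw [Fin.snoc_castSucc]
      rcases Fin.eq_castSucc_or_eq_last i with ⟨j, rfl⟩ | rfl
      · rw [Fin.succ_castSucc, Fin.snoc_castSucc]
        exact hchain j
      · rw [Fin.succ_last, Fin.snoc_last, hlast]
        refine Finset.ssubset_iff_subset_ne.mpr ⟨hM'E, fun h => ?_⟩
        rw [h] at hℓM'
        omega
    · intro i
      rcases Fin.eq_castSucc_or_eq_last i with ⟨j, rfl⟩ | rfl
      · rw [Fin.snoc_castSucc, Fin.val_castSucc]
        exact hbl j
      · rw [Fin.snoc_last, Fin.val_last]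
        exact ⟨hbrE, hℓE⟩
  · intro γ hγ
    rw [hfl] at hγ
    obtain ⟨-, -, hlast, -, -⟩ := hγ
    show Fin.snoc (Fin.init γ) E = γ
    conv_lhs => rw [← hlast]
    exact Fin.snoc_init_self γ
  · rintro ⟨M', γ'⟩ hp
    rw [Finset.mem_sigma] at hp
    obtain ⟨-, hγ'⟩ := hp
    rw [hfl] at hγ'
    obtain ⟨-, -, hlast, -, -⟩ := hγ'
    change γ' (Fin.last m) = M' at hlast
    show (⟨(Fin.snoc γ' E : Fin (m + 1 + 1) → Finset α) (Fin.last m).castSucc,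
        Fin.init (Fin.snoc γ' E : Fin (m + 1 + 1) → Finset α)⟩ :
        Σ _ : Finset α, Fin (m + 1) → Finset α) = ⟨M', γ'⟩
    rw [Fin.snoc_castSucc, Fin.init_snoc, hlast]
  · intro γ hγ
    rw [hfl] at hγ
    obtain ⟨-, -, hlast, -, -⟩ := hγ
    show Φ γ = Φ (Fin.snoc (Fin.init γ) E)
    conv_rhs => rw [← hlast]
    rw [Fin.snoc_init_self]

/-- The numerator of the flag summand for a flag extended by `E`:
`Π_{i ≤ m} a_{γ_{i+1}/γ_i}` splits off the last factor `a_{E/γ'_m}`. [cite: Panzer2022, Prop. 3.2] -/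
theorem flagNumerator_snoc (a : α → 𝕜) (m : ℕ) (γ' : Fin (m + 1) → Finset α) (E : Finset α) :
    (∏ i : Fin (m + 1), ∑ e ∈ (Fin.snoc γ' E : Fin (m + 1 + 1) → Finset α) i.succ \
        (Fin.snoc γ' E : Fin (m + 1 + 1) → Finset α) i.castSucc, a e) =
      (∏ i : Fin m, ∑ e ∈ γ' i.succ \ γ' i.castSucc, a e) * ∑ e ∈ E \ γ' (Fin.last m), a e := by
  rw [Fin.prod_univ_castSucc]
  congr 1
  · refine Finset.prod_congr rfl fun i _ => ?_
    rw [Fin.succ_castSucc, Fin.snoc_castSucc, Fin.snoc_castSucc]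
  · rw [Fin.succ_last, Fin.snoc_last, Fin.snoc_castSucc]

omit [DecidableEq α] in
/-- The denominator of the flag summand for a flag extended by `E`:
`Π_{1 ≤ i ≤ m} ω(γ_i)` splits off the last factor `ω(γ'_m)` (for `m ≥ 1`). [cite: Panzer2022, Prop. 3.2] -/
theorem flagDenominator_snoc (ℓ : Finset α → ℕ) (D : 𝕜) (a : α → 𝕜) (m : ℕ) (hm : 1 ≤ m)
    (γ' : Fin (m + 1) → Finset α) (E : Finset α) :
    (∏ i : Fin (m + 1), if (i : ℕ) = 0 then (1 : 𝕜) else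
        sdcOfCorank ℓ D a ((Fin.snoc γ' E : Fin (m + 1 + 1) → Finset α) i.castSucc)) =
      (∏ i : Fin m, if (i : ℕ) = 0 then (1 : 𝕜) else sdcOfCorank ℓ D a (γ' i.castSucc)) *
        sdcOfCorank ℓ D a (γ' (Fin.last m)) := by
  rw [Fin.prod_univ_castSucc]
  congr 1
  · refine Finset.prod_congr rfl fun i _ => ?_
    rw [Fin.snoc_castSucc, Fin.val_castSucc]
  · rw [Fin.snoc_castSucc, Fin.val_last, if_neg (by omega)]

/-- **The flag formula for an abstract corank function, by induction on the corank `m = ℓ(E)`**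
(Panzer 2022, Prop. 3.2, "iteration of this rule eventually leads to (hepp-1pi-flags)"):
for every bridgeless `E ⊆ E₀` with `ℓ(E) = m ≥ 1`,
`Hepp_D(E) = (1/a^E) Σ_{γ_• ∈ Fl(E)} Π_k a_{γ_k/γ_{k-1}} / Π_{0<k<m} ω(γ_k)`, pointwise where the
denominators `ω(γ)`, `∅ ≠ γ ⊊ E₀`, and the `a_e` do not vanish. [cite: Panzer2022, Prop. 3.2] -/
theorem heppSumOfCorank_eq_flagSum_aux (ℓ : Finset α → ℕ) (h0 : ℓ ∅ = 0)
    (hmono : ∀ γ δ : Finset α, γ ⊆ δ → ℓ γ ≤ ℓ δ)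
    (hstep : ∀ (γ : Finset α) (e : α), ℓ γ ≤ ℓ (γ.erase e) + 1)
    (hsup : ∀ A B : Finset α, ℓ A + ℓ B ≤ ℓ (A ∪ B) + ℓ (A ∩ B))
    (D : 𝕜) (a : α → 𝕜)
    (fl : (m : ℕ) → Finset α → Finset (Fin (m + 1) → Finset α))
    (hfl : ∀ (m : ℕ) (E : Finset α) (γ : Fin (m + 1) → Finset α), γ ∈ fl m E ↔
      (∀ i, γ i ⊆ E) ∧ γ 0 = ∅ ∧ γ (Fin.last m) = E ∧ (∀ i : Fin m, γ i.castSucc ⊂ γ i.succ) ∧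
        ∀ i : Fin (m + 1), IsBridgelessOfCorank ℓ (γ i) ∧ ℓ (γ i) = (i : ℕ))
    (E₀ : Finset α) (hω : ∀ γ ⊆ E₀, γ.Nonempty → γ ≠ E₀ → sdcOfCorank ℓ D a γ ≠ 0)
    (ha : ∀ e ∈ E₀, a e ≠ 0) (m : ℕ) (hm : 1 ≤ m) :
    ∀ E ⊆ E₀, IsBridgelessOfCorank ℓ E → ℓ E = m →
      heppSumOfCorank ℓ E D a = (∏ e ∈ E, a e)⁻¹ * ∑ γ ∈ fl m E,
        (∏ i : Fin m, ∑ e ∈ γ i.succ \ γ i.castSucc, a e) /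
          ∏ i : Fin m, if (i : ℕ) = 0 then 1 else sdcOfCorank ℓ D a (γ i.castSucc) := by
  obtain ⟨cs, hcs⟩ : ∃ cs : Finset α → 𝕜, ∀ F, cs F = ∑ τ ∈ orderings F,
      ∏ k ∈ Finset.Ico 1 (F.card + 1), (sdcOfCorank ℓ D a (τ.take k).toFinset)⁻¹ :=
    ⟨_, fun F => rfl⟩
  induction m, hm using Nat.le_induction with
  | base =>
    intro E hE hbr hℓ
    have hωE : ∀ γ ⊆ E, γ.Nonempty → γ ≠ E → sdcOfCorank ℓ D a γ ≠ 0 := fun γ hγ hne hneE =>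
      hω γ (hγ.trans hE) hne (fun h => hneE (by subst h; exact Finset.Subset.antisymm hγ hE))
    have haE : ∀ e ∈ E, a e ≠ 0 := fun e he => ha e (hE he)
    have hEne : E.Nonempty := by
      rw [Finset.nonempty_iff_ne_empty]
      rintro rfl
      rw [h0] at hℓ
      omega
    rw [heppSumOfCorank_recursion ℓ h0 hmono hstep hsup D a cs hcs hbr (by omega) hωE haE]
    rw [Finset.sum_eq_single_of_mem (∅ : Finset α)]
    rotate_left
    · rw [Finset.mem_filter, Finset.mem_powerset]
      exact ⟨Finset.empty_subset _, fun _ h => absurd h (Finset.notMem_empty _), by rw [h0, hℓ]⟩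
    · intro M' hM' hne
      exfalso
      apply hne
      rw [Finset.mem_filter] at hM'
      obtain ⟨-, hbrM', hℓM'⟩ := hM'
      by_contra hne'
      obtain ⟨x, hx⟩ := Finset.nonempty_iff_ne_empty.mpr hne'
      have := hbrM' x hx
      omega
    rw [Finset.sdiff_empty, charSum_empty ℓ D a cs hcs, mul_one]
    obtain ⟨γ₁, hγ₁0, hγ₁1⟩ : ∃ γ₁ : Fin (1 + 1) → Finset α, γ₁ 0 = ∅ ∧ γ₁ 1 = E :=
      ⟨fun i => if i = 0 then ∅ else E, by simp, by simp⟩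
    have hmem : γ₁ ∈ fl 1 E := by
      rw [hfl]
      refine ⟨?_, hγ₁0, hγ₁1, ?_, ?_⟩
      · intro i
        fin_cases i
        · simp [hγ₁0]
        · simp [hγ₁1]
      · intro i
        fin_cases i
        simpa [hγ₁0, hγ₁1] using hEne.empty_ssubset  -- ∅ ⊂ E
      · intro i
        fin_cases i
        · simp only [Fin.zero_eta, hγ₁0, h0, and_true]
          intro x hx
          exact absurd hx (Finset.notMem_empty x)
        · simpa [hγ₁1] using ⟨hbr, hℓ⟩
    rw [Finset.sum_eq_single_of_mem γ₁ hmem]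
    · simp [hγ₁0, hγ₁1]
      ring
    · intro γ hγ hne
      exfalso
      apply hne
      rw [hfl] at hγ
      obtain ⟨-, hz, hl, -, -⟩ := hγ
      funext i
      fin_cases i
      · simpa [hγ₁0] using hz
      · simpa [hγ₁1] using hl
  | succ m hm ih =>
    intro E hE hbr hℓ
    have hωE : ∀ γ ⊆ E, γ.Nonempty → γ ≠ E → sdcOfCorank ℓ D a γ ≠ 0 := fun γ hγ hne hneE =>
      hω γ (hγ.trans hE) hne (fun h => hneE (by subst h; exact Finset.Subset.antisymm hγ hE))
    have haE : ∀ e ∈ E, a e ≠ 0 := fun e he => ha e (hE he)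
    rw [heppSumOfCorank_recursion ℓ h0 hmono hstep hsup D a cs hcs hbr (by omega) hωE haE]
    have hT : ∀ M' ∈ E.powerset.filter (fun M' => IsBridgelessOfCorank ℓ M' ∧ ℓ M' + 1 = ℓ E),
        M' ⊆ E ∧ IsBridgelessOfCorank ℓ M' ∧ ℓ M' = m := by
      intro M' hM'
      rw [Finset.mem_filter, Finset.mem_powerset] at hM'
      exact ⟨hM'.1, hM'.2.1, by omega⟩
    have lhs : ∀ M' ∈ E.powerset.filter (fun M' => IsBridgelessOfCorank ℓ M' ∧ ℓ M' + 1 = ℓ E),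
        (∑ e ∈ E \ M', a e) * (∏ e ∈ E \ M', a e)⁻¹ * cs M' =
          ∑ γ' ∈ fl m M', (∏ e ∈ E, a e)⁻¹ * ((∑ e ∈ E \ M', a e) *
            (sdcOfCorank ℓ D a M')⁻¹ *
              ((∏ i : Fin m, ∑ e ∈ γ' i.succ \ γ' i.castSucc, a e) /
                ∏ i : Fin m, if (i : ℕ) = 0 then 1 else sdcOfCorank ℓ D a (γ' i.castSucc))) := by
      intro M' hM'
      obtain ⟨hM'E, hbrM', hℓM'⟩ := hT M' hM'
      have hM'ne : M'.Nonempty := by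
        rw [Finset.nonempty_iff_ne_empty]
        rintro rfl
        rw [h0] at hℓM'
        omega
      rw [charSum_eq_inv_mul_heppSumOfCorank ℓ D a cs hcs hM'ne,
        ih M' (hM'E.trans hE) hbrM' hℓM', Finset.mul_sum, Finset.mul_sum, Finset.mul_sum]
      refine Finset.sum_congr rfl fun γ' _ => ?_
      rw [← Finset.prod_sdiff hM'E, mul_inv]
      ring
    rw [Finset.sum_congr rfl lhs, sum_flags_succ ℓ fl hfl m hbr hℓ, Finset.mul_sum]
    refine Finset.sum_congr rfl fun M' hM' => ?_
    obtain ⟨-, -, hℓM'⟩ := hT M' hM'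
    rw [Finset.mul_sum]
    refine Finset.sum_congr rfl fun γ' hγ' => ?_
    rw [hfl] at hγ'
    obtain ⟨-, -, hlast, -, -⟩ := hγ'
    rw [flagNumerator_snoc, flagDenominator_snoc ℓ D a m hm, hlast, ← div_mul_div_comm]
    ring

/-- **Panzer's flag formula for an abstract corank function** (Prop. 3.2 with the corank of a
matroid replaced by any normalised, monotone, unit-increment, supermodular `ℓ`): for bridgeless
`E` with `ℓ(E) ≥ 1`, the Hepp sum of Def. 2.4 (free dimension `D`) equals the bridgeless-flag sum,
at every point where `ω(γ) ≠ 0` for `∅ ≠ γ ⊊ E` and all `a_e ≠ 0`. [cite: Panzer2022, Prop. 3.2] -/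
theorem heppSumOfCorank_eq_heppFlagSumOfCorank (ℓ : Finset α → ℕ) (h0 : ℓ ∅ = 0)
    (hmono : ∀ γ δ : Finset α, γ ⊆ δ → ℓ γ ≤ ℓ δ)
    (hstep : ∀ (γ : Finset α) (e : α), ℓ γ ≤ ℓ (γ.erase e) + 1)
    (hsup : ∀ A B : Finset α, ℓ A + ℓ B ≤ ℓ (A ∪ B) + ℓ (A ∩ B))
    {E : Finset α} (hbr : IsBridgelessOfCorank ℓ E) (hℓ : 1 ≤ ℓ E) (D : 𝕜) (a : α → 𝕜)
    (hω : ∀ γ ⊆ E, γ.Nonempty → γ ≠ E → sdcOfCorank ℓ D a γ ≠ 0) (ha : ∀ e ∈ E, a e ≠ 0) :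
    heppSumOfCorank ℓ E D a = heppFlagSumOfCorank ℓ E D a := by
  obtain ⟨fl, hfl⟩ : ∃ fl : (m : ℕ) → Finset α → Finset (Fin (m + 1) → Finset α),
      ∀ (m : ℕ) (E : Finset α) (γ : Fin (m + 1) → Finset α), γ ∈ fl m E ↔
        (∀ i, γ i ⊆ E) ∧ γ 0 = ∅ ∧ γ (Fin.last m) = E ∧
          (∀ i : Fin m, γ i.castSucc ⊂ γ i.succ) ∧
            ∀ i : Fin (m + 1), IsBridgelessOfCorank ℓ (γ i) ∧ ℓ (γ i) = (i : ℕ) :=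
    ⟨fun m E => (Fintype.piFinset fun _ => E.powerset).filter fun γ =>
        γ 0 = ∅ ∧ γ (Fin.last m) = E ∧ (∀ i : Fin m, γ i.castSucc ⊂ γ i.succ) ∧
          ∀ i : Fin (m + 1), IsBridgelessOfCorank ℓ (γ i) ∧ ℓ (γ i) = (i : ℕ),
      fun m E γ => by
        simp only [Finset.mem_filter, Fintype.mem_piFinset, Finset.mem_powerset]⟩
  rw [heppSumOfCorank_eq_flagSum_aux ℓ h0 hmono hstep hsup D a fl hfl E hω ha (ℓ E) hℓ E
      Finset.Subset.rfl hbr rfl, heppFlagSumOfCorank]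
  congr 1
  refine Finset.sum_congr ?_ fun _ _ => rfl
  ext γ
  rw [hfl, mem_bridgelessFlagsOfCorank_iff]

end FlagFormula

section MatroidLayer

/-! ### The corank of a finite matroid satisfies the axioms; connected ⇒ bridgeless -/

variable {α : Type*} [DecidableEq α]

omit [DecidableEq α] in
/-- The rank of a finite set, as a natural number cast back to `ℕ∞`. [folklore] -/
theorem natCast_eRk_toNat (M : Matroid α) (γ : Finset α) :
    (((M.eRk (γ : Set α)).toNat : ℕ) : ℕ∞) = M.eRk (γ : Set α) := by
  apply ENat.coe_toNat
  have h : M.eRk (γ : Set α) ≤ (γ.card : ℕ∞) := by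
    simpa [Set.encard_coe_eq_coe_finsetCard] using M.eRk_le_encard (γ : Set α)
  exact ne_top_of_le_ne_top (ENat.coe_ne_top _) h

omit [DecidableEq α] in
/-- Monotonicity of the rank of finite sets. [folklore] -/
theorem eRk_toNat_mono (M : Matroid α) {γ δ : Finset α} (h : γ ⊆ δ) :
    (M.eRk (γ : Set α)).toNat ≤ (M.eRk (δ : Set α)).toNat := by
  have key : (((M.eRk (γ : Set α)).toNat : ℕ) : ℕ∞) ≤ (((M.eRk (δ : Set α)).toNat : ℕ) : ℕ∞) := by
    rw [natCast_eRk_toNat, natCast_eRk_toNat]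
    exact M.eRk_mono (Finset.coe_subset.mpr h)
  exact_mod_cast key

/-- The rank grows by at most the number of added elements. [folklore] -/
theorem eRk_toNat_le_add_card_sdiff (M : Matroid α) {γ δ : Finset α} (h : γ ⊆ δ) :
    (M.eRk (δ : Set α)).toNat ≤ (M.eRk (γ : Set α)).toNat + (δ \ γ).card := by
  have key : (((M.eRk (δ : Set α)).toNat : ℕ) : ℕ∞) ≤
      (((M.eRk (γ : Set α)).toNat + (δ \ γ).card : ℕ) : ℕ∞) := by
    rw [Nat.cast_add, natCast_eRk_toNat, natCast_eRk_toNat, ← Set.encard_coe_eq_coe_finsetCard,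
      Finset.coe_sdiff]
    calc M.eRk (δ : Set α) = M.eRk ((γ : Set α) ∪ ((δ : Set α) \ (γ : Set α))) := by
          rw [Set.union_sdiff_cancel (Finset.coe_subset.mpr h)]
      _ ≤ M.eRk (γ : Set α) + ((δ : Set α) \ (γ : Set α)).encard :=
          M.eRk_union_le_eRk_add_encard _ _
  exact_mod_cast key

/-- **The corank of a matroid is monotone**: `γ ⊆ δ ⇒ ℓ(γ) ≤ ℓ(δ)`. [folklore] -/
theorem corank_mono (M : Matroid α) (γ δ : Finset α) (h : γ ⊆ δ) :
    corank M γ ≤ corank M δ := by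
  unfold corank
  have h1 := eRk_toNat_le_add_card_sdiff M h
  have h2 := Finset.card_sdiff_add_card_eq_card h
  have h3 := eRk_toNat_le_card M γ
  omega

/-- **Unit increments of the corank**: `ℓ(γ) ≤ ℓ(γ ∖ e) + 1`. [folklore] -/
theorem corank_le_corank_erase_add_one (M : Matroid α) (γ : Finset α) (e : α) :
    corank M γ ≤ corank M (γ.erase e) + 1 := by
  unfold corank
  by_cases he : e ∈ γ
  · have h1 := eRk_toNat_mono M (Finset.erase_subset e γ)
    have h2 := Finset.card_erase_add_one he
    have h3 := eRk_toNat_le_card M (γ.erase e)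
    omega
  · rw [Finset.erase_eq_of_notMem he]
    omega

/-- **Supermodularity of the corank** (from the submodularity of the rank,
`Matroid.eRk_inter_add_eRk_union_le`): `ℓ(A) + ℓ(B) ≤ ℓ(A ∪ B) + ℓ(A ∩ B)`. [folklore] -/
theorem corank_supermodular (M : Matroid α) (A B : Finset α) :
    corank M A + corank M B ≤ corank M (A ∪ B) + corank M (A ∩ B) := by
  unfold corank
  have key : (((M.eRk ((A ∩ B : Finset α) : Set α)).toNat +
      (M.eRk ((A ∪ B : Finset α) : Set α)).toNat : ℕ) : ℕ∞) ≤
        (((M.eRk (A : Set α)).toNat + (M.eRk (B : Set α)).toNat : ℕ) : ℕ∞) := by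
    rw [Nat.cast_add, Nat.cast_add, natCast_eRk_toNat, natCast_eRk_toNat, natCast_eRk_toNat,
      natCast_eRk_toNat, Finset.coe_inter, Finset.coe_union]
    exact M.eRk_inter_add_eRk_union_le _ _
  have h1 : (M.eRk ((A ∩ B : Finset α) : Set α)).toNat +
      (M.eRk ((A ∪ B : Finset α) : Set α)).toNat ≤
        (M.eRk (A : Set α)).toNat + (M.eRk (B : Set α)).toNat := by exact_mod_cast key
  have h2 := Finset.card_union_add_card_inter A B
  have h3 := eRk_toNat_le_card M A
  have h4 := eRk_toNat_le_card M B
  have h5 := eRk_toNat_le_card M (A ∪ B)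
  have h6 := eRk_toNat_le_card M (A ∩ B)
  omega

/-- **A connected matroid with at least one loop is bridgeless** (Panzer 2022, §3.1: "Connected
matroids are thus always bridgeless, except for `M ≅ U_{1,1}`"; a bridge `e` splits
`M = (M ∖ e) ⊕ M|_e`, Def. 2.15). [cite: Panzer2022, §3.1] -/
theorem isBridgeless_groundFinset_of_isConnectedMatroid (M : Matroid α) [M.Finite]
    (hM : IsConnectedMatroid M) (hℓ : 1 ≤ corank M (groundFinset M)) :
    IsBridgelessOfCorank (corank M) (groundFinset M) := by
  intro e he
  by_contra hlt
  have heq : corank M ((groundFinset M).erase e) = corank M (groundFinset M) :=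
    le_antisymm (corank_mono M _ _ (Finset.erase_subset e _)) (not_lt.mp hlt)
  have hr : (M.eRk ((groundFinset M : Finset α) : Set α)).toNat =
      (M.eRk (((groundFinset M).erase e : Finset α) : Set α)).toNat + 1 := by
    have h1 := eRk_toNat_add_corank M (groundFinset M)
    have h2 := eRk_toNat_add_corank M ((groundFinset M).erase e)
    have h3 := Finset.card_erase_add_one he
    omega
  have hrE : M.eRk M.E = M.eRk (M.E \ {e}) + 1 := by
    have h1 := natCast_eRk_toNat M (groundFinset M)
    have h2 := natCast_eRk_toNat M ((groundFinset M).erase e)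
    rw [coe_groundFinset] at h1
    rw [Finset.coe_erase, coe_groundFinset] at h2 hr
    rw [← h1, ← h2, hr, Nat.cast_add, Nat.cast_one]
  have hne : ((groundFinset M).erase e).Nonempty := by
    rw [Finset.nonempty_iff_ne_empty]
    intro h
    rw [h, corank_empty] at heq
    omega
  have heE : e ∈ M.E := mem_groundFinset.mp he
  have h3 : ({e} : Set α) ≠ M.E := by
    intro h
    obtain ⟨x, hx⟩ := hne
    rw [Finset.mem_erase] at hx
    have hx' : x ∈ M.E := mem_groundFinset.mp hx.2
    rw [← h, Set.mem_singleton_iff] at hx'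
    exact hx.1 hx'
  have hsub : ({e} : Set α) ⊆ M.E := Set.singleton_subset_iff.mpr heE
  refine hM {e} hsub (Set.singleton_nonempty e) h3 (Matroid.ext_indep ?_ ?_)
  · rw [Matroid.disjointSum_ground_eq, Matroid.restrict_ground_eq, Matroid.restrict_ground_eq,
      Set.union_sdiff_cancel hsub]
  · intro I hI
    rw [Matroid.disjointSum_indep_iff, Matroid.restrict_indep_iff, Matroid.restrict_indep_iff,
      Matroid.restrict_ground_eq, Matroid.restrict_ground_eq, Set.union_sdiff_cancel hsub]
    constructor
    · intro hind
      exact ⟨⟨hind.subset Set.inter_subset_left, Set.inter_subset_right⟩,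
        ⟨hind.subset Set.inter_subset_left, Set.inter_subset_right⟩, hI⟩
    · rintro ⟨-, ⟨hJ, -⟩, -⟩
      by_cases heI : e ∈ I
      · have hIfin : I.Finite := M.ground_finite.subset hI
        have hYfin : (M.E \ {e}).Finite := M.ground_finite.subset Set.sdiff_subset
        have hIY : I ∪ (M.E \ {e}) = M.E := by
          apply Set.Subset.antisymm (Set.union_subset hI Set.sdiff_subset)
          intro x hx
          by_cases hxe : x = e
          · exact Or.inl (hxe ▸ heI)
          · exact Or.inr ⟨hx, hxe⟩
        have hJI : I ∩ (M.E \ {e}) = I \ {e} := by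
          ext x
          simp only [Set.mem_inter_iff, Set.mem_sdiff, Set.mem_singleton_iff]
          exact ⟨fun ⟨hxI, _, hxe⟩ => ⟨hxI, hxe⟩, fun ⟨hxI, hxe⟩ => ⟨hxI, hI hxI, hxe⟩⟩
        have hsm := M.eRk_inter_add_eRk_union_le I (M.E \ {e})
        rw [hIY, hJ.eRk_eq_encard, hJI, hrE, add_comm (M.eRk (M.E \ {e})) 1, ← add_assoc,
          Set.encard_sdiff_singleton_add_one heI] at hsm
        have hYtop : M.eRk (M.E \ {e}) ≠ ⊤ :=
          ne_top_of_le_ne_top hYfin.encard_lt_top.ne (M.eRk_le_encard _)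
        have h1 : I.encard ≤ M.eRk I := WithTop.le_of_add_le_add_right hYtop hsm
        exact (Matroid.indep_iff_eRk_eq_encard_of_finite hIfin).mpr
          (le_antisymm (M.eRk_le_encard I) h1)
      · have hII : I ∩ (M.E \ {e}) = I := by
          apply Set.inter_eq_left.mpr
          intro x hx
          refine ⟨hI hx, fun hxe => heI ?_⟩
          rw [Set.mem_singleton_iff] at hxe
          exact hxe ▸ hx
        rwa [hII] at hJ

/-- **Panzer's flag formula** (discharge of the named fact `Panzer2022_prop_3_2`; Panzer 2022,
Prop. 3.2, free-dimension form): for a connected finite matroid with `ℓ(M) ≥ 1`,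
`Hepp_D(M, a⃗) = (1/(a_1⋯a_N)) Σ_{γ_• ∈ Fl^{1PI}(M)} a_{γ₁/γ₀}⋯a_{γ_ℓ/γ_{ℓ-1}} / (ω(γ₁)⋯ω(γ_{ℓ-1}))`
at every point of a field where no `ω(γ)` (`∅ ≠ γ ⊊ E`) and no `a_e` vanishes. Obtained from
`heppSumOfCorank_eq_heppFlagSumOfCorank` with `ℓ = corank M` (axioms: `corank_empty`,
`corank_mono`, `corank_le_corank_erase_add_one`, `corank_supermodular`) and
`isBridgeless_groundFinset_of_isConnectedMatroid`. [cite: Panzer2022, Prop. 3.2] -/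
theorem Panzer2022_prop_3_2_holds : Panzer2022_prop_3_2 := by
  intro α _ 𝕜 _ _ M _ hM hℓ D a hω ha
  exact heppSumOfCorank_eq_heppFlagSumOfCorank (corank M) (corank_empty M) (corank_mono M)
    (corank_le_corank_erase_add_one M) (corank_supermodular M)
    (isBridgeless_groundFinset_of_isConnectedMatroid M hM hℓ) hℓ D a hω ha

end MatroidLayer

end Literature.Combinatorics.Matroid
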